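import Literature.NumberTheory.K2Lit.AdelicPlaceSplitting
import Literature.NumberTheory.K2Lit.DoublingZetaIntegral
import Literature.NumberTheory.Automorphic.UnitaryGroupAdelicProduct
import Mathlib.MeasureTheory.Integral.Bochner.Basic
import Mathlib.MeasureTheory.Constructions.Pi
import HarnessLib

/-!
# Local and `S`-partial doubling zeta integrals, the doubling Hecke operator (leaf D7b of the LOCAL SEAM of s23)

Topic `NumberTheory/K2Lit` (Track B build stream 29; DEPMAP v2.1 `Cruxes/HLiu418/Lines/K2_Liu_LocalSeam_s23.md` §1 (a)–(c), §2 (LS0)–(LS1),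
§3 file #22; LEAD «M-154r» Q1 «HECKE BYPASS»: no Flath, no `π_v`, no local `L`-factors as objects —
`Z(s) = (∏_{v∉S} c_v(s))·Z_S(s)`). The ANALYTIC CARRIERS of the local seam, junk-valued Bochner ∕ Lebesgue definitions in the
style of ★ `K2Lit/DoublingZetaIntegral` (`doublingZeta`): **no `sorry`, no named fact, no instance, no notation.**

* §1 (generic, any measurable group `G`, any Banach space `V`): `localZeta ν Λ ξ = ∫_G Λ(g) ξ(g) dν` (the local zeta integral of a
  kernel `Λ` — at a finite place `Λ = ★ lambdaLoc v f_v = f_v ∘ ι_v(·,1)` — against a matrix-coefficient-like function `ξ`),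
  `LocalZetaConverges`; **`doublingHeckeOp ν Λ τ u = ∫_G Λ(g) • τ(g) u dν`** — the OPERATOR of (LS1) «`∫ Λ_{s,v}(g) τ(g) u dg = c_v(s,t)·u`»
  (statement #28s carries the EXPLICIT `c_v`; nothing is posited here), `IsDoublingHeckeEigenvector`, linearity ∕ zero lemmas.
* §2 (the S-SPLITTING of the global integral, (LS0)+(c)): for the unitary datum `𝒢 = ★ UnitaryGroup.adelicGroupData L⁺ L c N H` and a
  finite set `S` of finite places, `placesEmbedFin S : (Π_{v∈S} U(H)(L⁺_v)) →* U(H)(𝔸_f)` (★ `splitPlaces.symm (·, 1)`),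
  `placesEmbed S : U(H)(L⁺ ⊗ ℝ) × Π_{v∈S} U(H)(L⁺_v) →* U(H)(𝔸)` (★ `adelicProdEquiv.symm`), continuity; **`zetaS S νinf νS μ ιA f φ₁ φ₂ =
  ∫_{G_∞ × G_S} f(ι(ιA g, 1)) ⟨π(g)φ₁, φ₂⟩ d(νinf ⊗ ⊗_{v∈S} ν_v)`** — DEPMAP (c)'s `Z_S(s)` (same integrand as ★ `doublingZeta`, read on
  `G_S`), `ZetaSConverges`, zero lemmas.

References: J.-S. Li, J. reine angew. Math. 428 (1992) §3 Thm. 3.1 [Li1992]; I. Piatetski-Shapiro, S. Rallis, LNM 1254 (1987) Part A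
§1, §6 [GelbartPiatetskishapiroRallis1987]; Y. Liu, ANT 5 (2011) §2B–§2C pp. 862–863 [Liu2011]; S. Yamana, *L-functions and theta
correspondence for classical groups*, Invent. Math. 196 (2014) §7 [Yamana2014].
-/

set_option autoImplicit false

noncomputable section

open scoped Matrix
open NumberField IsDedekindDomain MeasureTheory

namespace Literature.NumberTheory.K2Lit.SiegelDoubled

open Literature.NumberTheory.Automorphic Literature.NumberTheory.GaloisRepresentations
open Literature.NumberTheory.GelbartRogawski1991 Literature.NumberTheory.GelbartRogawski1991.GRConstruction
open Literature.NumberTheory.K2Lit.PlaceSplitting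

/-! ## §1 Local zeta integrals and the doubling Hecke operator (generic) -/

section Local

variable {G : Type} [MeasurableSpace G]

/-- **The local doubling zeta integral `Z(Λ, ξ) = ∫_G Λ(g) ξ(g) dν`** — `Λ = f_v(ι_v(·, 1))` a local section read on `G_v = U(V)(F_v)`
(★ `lambdaLoc`), `ξ` a matrix-coefficient-like function (e.g. `g ↦ ⟨τ(g)u, u′⟩`); junk `0` when not integrable.
[cite: Liu2011, §2C p. 863] [cite: Li1992, §3] -/
def localZeta (ν : Measure G) (Λ ξ : G → ℂ) : ℂ :=
  ∫ g, Λ g * ξ g ∂ν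

/-- absolute convergence of the local zeta integral (Mathlib `Integrable`). [cite: Liu2011, §2C p. 863] -/
def LocalZetaConverges (ν : Measure G) (Λ ξ : G → ℂ) : Prop :=
  Integrable (fun g => Λ g * ξ g) ν

/-- the local zeta integral of the zero kernel vanishes. [cite: Liu2011, §2C p. 863] -/
theorem localZeta_zero_left (ν : Measure G) (ξ : G → ℂ) : localZeta ν (fun _ => 0) ξ = 0 := by
  simp [localZeta]

/-- the local zeta integral against `ξ = 0` vanishes. [cite: Liu2011, §2C p. 863] -/
theorem localZeta_zero_right (ν : Measure G) (Λ : G → ℂ) : localZeta ν Λ (fun _ => 0) = 0 := by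
  simp [localZeta]

/-- the zero kernel converges (trivially). [cite: Liu2011, §2C p. 863] -/
theorem localZetaConverges_zero_left (ν : Measure G) (ξ : G → ℂ) : LocalZetaConverges ν (fun _ => 0) ξ := by
  simp [LocalZetaConverges]

variable {V : Type} [NormedAddCommGroup V] [NormedSpace ℂ V]

/-- **The doubling Hecke operator `T(Λ) u = ∫_G Λ(g) • τ(g) u dν`** (Bochner integral in a Banach space `V` on which `G` acts by
`τ`; junk `0` when not integrable) — the operator of the HECKE FORM of the unramified computation: for `Λ = Λ_{s,v}` bi-`K_v`-invariant
and `u` a `K_v`-fixed Hecke eigenvector, `T(Λ_{s,v}) u = c_v(s, t)·u` with `c_v` EXPLICIT (file #28; nothing posited here).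
[cite: Li1992, §3 Thm. 3.1] [cite: GelbartPiatetskishapiroRallis1987, Part A §6] -/
def doublingHeckeOp (ν : Measure G) (Λ : G → ℂ) (τ : G → V →L[ℂ] V) (u : V) : V :=
  ∫ g, Λ g • τ g u ∂ν

/-- convergence of the operator integral at `u` (Mathlib `Integrable`). [cite: Li1992, §3 Thm. 3.1] -/
def DoublingHeckeOpConverges (ν : Measure G) (Λ : G → ℂ) (τ : G → V →L[ℂ] V) (u : V) : Prop :=
  Integrable (fun g => Λ g • τ g u) ν

/-- **`u` is a doubling Hecke eigenvector with eigenvalue `c`**: `∫ Λ(g) • τ(g) u dν = c • u` (with convergence).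
[cite: Li1992, §3 Thm. 3.1] -/
def IsDoublingHeckeEigenvector (ν : Measure G) (Λ : G → ℂ) (τ : G → V →L[ℂ] V) (u : V) (c : ℂ) : Prop :=
  DoublingHeckeOpConverges ν Λ τ u ∧ doublingHeckeOp ν Λ τ u = c • u

/-- the operator of the zero kernel is zero. [cite: Li1992, §3 Thm. 3.1] -/
theorem doublingHeckeOp_zero_kernel (ν : Measure G) (τ : G → V →L[ℂ] V) (u : V) :
    doublingHeckeOp ν (fun _ => 0) τ u = 0 := by
  simp [doublingHeckeOp]

/-- the operator kills `u = 0`. [cite: Li1992, §3 Thm. 3.1] -/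
theorem doublingHeckeOp_zero (ν : Measure G) (Λ : G → ℂ) (τ : G → V →L[ℂ] V) : doublingHeckeOp ν Λ τ 0 = 0 := by
  simp [doublingHeckeOp]

/-- `0` is an eigenvector for every `c` (the degenerate corner; statements quantify over `u ≠ 0`). [cite: Li1992, §3 Thm. 3.1] -/
theorem isDoublingHeckeEigenvector_zero (ν : Measure G) (Λ : G → ℂ) (τ : G → V →L[ℂ] V) (c : ℂ) :
    IsDoublingHeckeEigenvector ν Λ τ 0 c := by
  refine ⟨?_, ?_⟩
  · simp [DoublingHeckeOpConverges]
  · simp [doublingHeckeOp]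

/-- the operator is additive in `u` where it converges. [cite: Li1992, §3 Thm. 3.1] -/
theorem doublingHeckeOp_add (ν : Measure G) (Λ : G → ℂ) (τ : G → V →L[ℂ] V) {u u' : V}
    (hu : DoublingHeckeOpConverges ν Λ τ u) (hu' : DoublingHeckeOpConverges ν Λ τ u') :
    doublingHeckeOp ν Λ τ (u + u') = doublingHeckeOp ν Λ τ u + doublingHeckeOp ν Λ τ u' := by
  simp only [doublingHeckeOp, map_add, smul_add]
  exact integral_add hu hu'

/-- the operator is homogeneous in `u`. [cite: Li1992, §3 Thm. 3.1] -/
theorem doublingHeckeOp_smul (ν : Measure G) (Λ : G → ℂ) (τ : G → V →L[ℂ] V) (a : ℂ) (u : V) :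
    doublingHeckeOp ν Λ τ (a • u) = a • doublingHeckeOp ν Λ τ u := by
  simp only [doublingHeckeOp, map_smul, smul_comm (Λ _) a, integral_smul]

/-- **a scalar matrix coefficient from an eigenvector**: if `T(Λ) u = c • u` then for every continuous linear functional `ℓ`,
`∫ Λ(g) ℓ(τ(g) u) dν = c · ℓ(u)` — the passage from the operator identity (LS1) to the scalar local zeta value `Z_v = c_v · ⟨u, u′⟩`.
[cite: Li1992, §3 Thm. 3.1] [cite: Liu2011, §2C (2-4) p. 863] -/
theorem localZeta_eq_of_isDoublingHeckeEigenvector [CompleteSpace V] (ν : Measure G) (Λ : G → ℂ) (τ : G → V →L[ℂ] V)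
    {u : V} {c : ℂ}
    (h : IsDoublingHeckeEigenvector ν Λ τ u c) (ℓ : V →L[ℂ] ℂ) :
    localZeta ν Λ (fun g => ℓ (τ g u)) = c * ℓ u := by
  have h1 : ∫ g, ℓ (Λ g • τ g u) ∂ν = ℓ (∫ g, Λ g • τ g u ∂ν) := ℓ.integral_comp_comm h.1
  have h2 : (fun g => Λ g * ℓ (τ g u)) = fun g => ℓ (Λ g • τ g u) := by
    funext g; rw [map_smul, smul_eq_mul]
  rw [localZeta, h2, h1]
  change ℓ (doublingHeckeOp ν Λ τ u) = _
  rw [h.2, map_smul, smul_eq_mul]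

end Local

/-! ## §2 The `S`-part `Z_S` of the global doubling zeta integral -/

section Global

variable (L : Type) [Field L] [NumberField L] [IsCMField L]
variable {N M n : ℕ} (e : Fin N × Fin M ≃ Fin n)
  (dV : Fin N → L) (hdV : ∀ i, IsCMField.complexConj L (dV i) = dV i)
  (dW : Fin M → L) (hdW : ∀ i, IsCMField.complexConj L (dW i) = dW i)
  (H : Matrix (Fin N) (Fin N) L)
  (S : Finset (HeightOneSpectrum (𝓞 (Fp L)))) [DecidableEq (HeightOneSpectrum (𝓞 (Fp L)))]

/-- **`G_S ↪ G(𝔸_f)`, `(g_v)_{v∈S} ↦ (g_v at v ∈ S, 1 off S)`** (★ `splitPlaces.symm (·, 1)`). [cite: Liu2011, §2B p. 862] -/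
def placesEmbedFin : (Π v : S, UnitaryGroup.localPi L (IsCMField.complexConj L) N H v.1) →*
    UnitaryGroup.finAdelic (Fp L) L (IsCMField.complexConj L) N H :=
  (splitPlaces (Fp L) L (IsCMField.complexConj L) N H S).symm.toMonoidHom.comp (MonoidHom.inl _ _)

/-- `placesEmbedFin S x = splitPlaces.symm (x, 1)`. [cite: Liu2011, §2B p. 862] -/
theorem placesEmbedFin_apply (x : Π v : S, UnitaryGroup.localPi L (IsCMField.complexConj L) N H v.1) :
    placesEmbedFin L H S x = (splitPlaces (Fp L) L (IsCMField.complexConj L) N H S).symm (x, 1) :=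
  rfl

/-- the `S`-coordinates of `placesEmbedFin S x` are `x`, the others are `1`. [cite: Liu2011, §2B p. 862] -/
theorem splitPlaces_placesEmbedFin (x : Π v : S, UnitaryGroup.localPi L (IsCMField.complexConj L) N H v.1) :
    splitPlaces (Fp L) L (IsCMField.complexConj L) N H S (placesEmbedFin L H S x) = (x, 1) :=
  (splitPlaces (Fp L) L (IsCMField.complexConj L) N H S).apply_symm_apply _

/-- `placesEmbedFin S` is continuous. [cite: Liu2011, §2B p. 862] -/
theorem continuous_placesEmbedFin : Continuous (placesEmbedFin L H S) :=
  (splitPlaces (Fp L) L (IsCMField.complexConj L) N H S).symm.continuous.comp (continuous_id.prodMk continuous_const)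

/-- **`G_∞ × G_S ↪ G(𝔸)`**, `(g_∞, (g_v)_{v∈S}) ↦ (g_∞, 1)·(1, g_S)` (★ `adelicProdEquiv.symm`). [cite: Liu2011, §2B p. 862] [cite: BorelJacquet1979, §4.1] -/
def placesEmbed : UnitaryGroup.arch (Fp L) L (IsCMField.complexConj L) N H ×
      (Π v : S, UnitaryGroup.localPi L (IsCMField.complexConj L) N H v.1) →*
    (UnitaryGroup.adelicGroupData (Fp L) L (IsCMField.complexConj L) N H).Adelic :=
  (UnitaryGroup.adelicProdEquiv (Fp L) L (IsCMField.complexConj L) N H).symm.toMonoidHom.comp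
    (MonoidHom.prodMap (MonoidHom.id _) (placesEmbedFin L H S))

/-- `placesEmbed S (a, x) = adelicProdEquiv.symm (a, placesEmbedFin S x)`. [cite: BorelJacquet1979, §4.1] -/
theorem placesEmbed_apply (a : UnitaryGroup.arch (Fp L) L (IsCMField.complexConj L) N H)
    (x : Π v : S, UnitaryGroup.localPi L (IsCMField.complexConj L) N H v.1) :
    placesEmbed L H S (a, x) =
      (UnitaryGroup.adelicProdEquiv (Fp L) L (IsCMField.complexConj L) N H).symm (a, placesEmbedFin L H S x) :=
  rfl

/-- `placesEmbed S` is continuous. [cite: BorelJacquet1979, §4.1] -/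
theorem continuous_placesEmbed : Continuous (placesEmbed L H S) :=
  (UnitaryGroup.adelicProdEquiv (Fp L) L (IsCMField.complexConj L) N H).symm.continuous.comp
    (continuous_fst.prodMk ((continuous_placesEmbedFin L H S).comp continuous_snd))

variable [MeasurableSpace (UnitaryGroup.arch (Fp L) L (IsCMField.complexConj L) N H)]
  [∀ v : HeightOneSpectrum (𝓞 (Fp L)), MeasurableSpace (UnitaryGroup.localPi L (IsCMField.complexConj L) N H v)]

/-- **`Z_S(f, φ₁, φ₂) = ∫_{G_∞ × G_S} f(ι(ιA g, 1)) ⟨π(g)φ₁, φ₂⟩ d(ν_∞ ⊗ ⊗_{v∈S} ν_v)`** — the `S`-PART of the doubling zeta integral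
(★ `doublingZeta`'s integrand read on `G_∞ × G_S` through `placesEmbed S`), the `Z_S(s)` of «`Z(s) = (∏_{v∉S} c_v(s))·Z_S(s)`» (DEPMAP
(c)); junk `0` when not integrable. No claim that `Z_S` factors further. [cite: Liu2011, §2B Prop. 2.3 p. 862] [cite: Yamana2014, §7] -/
def zetaS (νinf : Measure (UnitaryGroup.arch (Fp L) L (IsCMField.complexConj L) N H))
    (νS : ∀ v : S, Measure (UnitaryGroup.localPi L (IsCMField.complexConj L) N H v.1))
    (μ : Measure (UnitaryGroup.adelicGroupData (Fp L) L (IsCMField.complexConj L) N H).automorphicQuotient)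
    (ιA : (UnitaryGroup.adelicGroupData (Fp L) L (IsCMField.complexConj L) N H).Adelic →*
      UnitaryGroup.adelic (Fp L) L (IsCMField.complexConj L) N (Matrix.diagonal dV))
    (f : HA L e dV hdV dW hdW → ℂ)
    (φ₁ φ₂ : (UnitaryGroup.adelicGroupData (Fp L) L (IsCMField.complexConj L) N H).automorphicQuotient → ℂ) : ℂ :=
  ∫ x, f (iotaLeft L e dV hdV dW hdW (ιA (placesEmbed L H S x))) *
      quotMatrixCoeff (UnitaryGroup.adelicGroupData (Fp L) L (IsCMField.complexConj L) N H) μ φ₁ φ₂ (placesEmbed L H S x)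
    ∂(νinf.prod (Measure.pi νS))

/-- absolute convergence of `Z_S` (Mathlib `Integrable` on `G_∞ × G_S`). [cite: Liu2011, §2B Prop. 2.3 p. 862] -/
def ZetaSConverges (νinf : Measure (UnitaryGroup.arch (Fp L) L (IsCMField.complexConj L) N H))
    (νS : ∀ v : S, Measure (UnitaryGroup.localPi L (IsCMField.complexConj L) N H v.1))
    (μ : Measure (UnitaryGroup.adelicGroupData (Fp L) L (IsCMField.complexConj L) N H).automorphicQuotient)
    (ιA : (UnitaryGroup.adelicGroupData (Fp L) L (IsCMField.complexConj L) N H).Adelic →*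
      UnitaryGroup.adelic (Fp L) L (IsCMField.complexConj L) N (Matrix.diagonal dV))
    (f : HA L e dV hdV dW hdW → ℂ)
    (φ₁ φ₂ : (UnitaryGroup.adelicGroupData (Fp L) L (IsCMField.complexConj L) N H).automorphicQuotient → ℂ) : Prop :=
  Integrable (fun x => f (iotaLeft L e dV hdV dW hdW (ιA (placesEmbed L H S x))) *
      quotMatrixCoeff (UnitaryGroup.adelicGroupData (Fp L) L (IsCMField.complexConj L) N H) μ φ₁ φ₂ (placesEmbed L H S x))
    (νinf.prod (Measure.pi νS))

/-- `Z_S(s)` for a family of sections `s ↦ f_s`. [cite: Liu2011, §2B Prop. 2.3 p. 862] -/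
def zetaSFamily (νinf : Measure (UnitaryGroup.arch (Fp L) L (IsCMField.complexConj L) N H))
    (νS : ∀ v : S, Measure (UnitaryGroup.localPi L (IsCMField.complexConj L) N H v.1))
    (μ : Measure (UnitaryGroup.adelicGroupData (Fp L) L (IsCMField.complexConj L) N H).automorphicQuotient)
    (ιA : (UnitaryGroup.adelicGroupData (Fp L) L (IsCMField.complexConj L) N H).Adelic →*
      UnitaryGroup.adelic (Fp L) L (IsCMField.complexConj L) N (Matrix.diagonal dV))
    (f : ℂ → HA L e dV hdV dW hdW → ℂ)
    (φ₁ φ₂ : (UnitaryGroup.adelicGroupData (Fp L) L (IsCMField.complexConj L) N H).automorphicQuotient → ℂ) (s : ℂ) : ℂ :=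
  zetaS L e dV hdV dW hdW H S νinf νS μ ιA (f s) φ₁ φ₂

/-- `Z_S` of the zero section vanishes. [cite: Liu2011, §2B Prop. 2.3 p. 862] -/
theorem zetaS_zero_section (νinf : Measure (UnitaryGroup.arch (Fp L) L (IsCMField.complexConj L) N H))
    (νS : ∀ v : S, Measure (UnitaryGroup.localPi L (IsCMField.complexConj L) N H v.1))
    (μ : Measure (UnitaryGroup.adelicGroupData (Fp L) L (IsCMField.complexConj L) N H).automorphicQuotient)
    (ιA : (UnitaryGroup.adelicGroupData (Fp L) L (IsCMField.complexConj L) N H).Adelic →*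
      UnitaryGroup.adelic (Fp L) L (IsCMField.complexConj L) N (Matrix.diagonal dV))
    (φ₁ φ₂ : (UnitaryGroup.adelicGroupData (Fp L) L (IsCMField.complexConj L) N H).automorphicQuotient → ℂ) :
    zetaS L e dV hdV dW hdW H S νinf νS μ ιA (fun _ => 0) φ₁ φ₂ = 0 := by
  simp [zetaS]

/-- `Z_S` vanishes for `φ₁ = 0`. [cite: Liu2011, §2B Prop. 2.3 p. 862] -/
theorem zetaS_zero_left (νinf : Measure (UnitaryGroup.arch (Fp L) L (IsCMField.complexConj L) N H))
    (νS : ∀ v : S, Measure (UnitaryGroup.localPi L (IsCMField.complexConj L) N H v.1))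
    (μ : Measure (UnitaryGroup.adelicGroupData (Fp L) L (IsCMField.complexConj L) N H).automorphicQuotient)
    (ιA : (UnitaryGroup.adelicGroupData (Fp L) L (IsCMField.complexConj L) N H).Adelic →*
      UnitaryGroup.adelic (Fp L) L (IsCMField.complexConj L) N (Matrix.diagonal dV))
    (f : HA L e dV hdV dW hdW → ℂ)
    (φ₂ : (UnitaryGroup.adelicGroupData (Fp L) L (IsCMField.complexConj L) N H).automorphicQuotient → ℂ) :
    zetaS L e dV hdV dW hdW H S νinf νS μ ιA f (fun _ => 0) φ₂ = 0 := by
  simp [zetaS, quotMatrixCoeff_zero_left]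

/-- the zero section's `Z_S` converges (trivially). [cite: Liu2011, §2B Prop. 2.3 p. 862] -/
theorem zetaSConverges_zero_section (νinf : Measure (UnitaryGroup.arch (Fp L) L (IsCMField.complexConj L) N H))
    (νS : ∀ v : S, Measure (UnitaryGroup.localPi L (IsCMField.complexConj L) N H v.1))
    (μ : Measure (UnitaryGroup.adelicGroupData (Fp L) L (IsCMField.complexConj L) N H).automorphicQuotient)
    (ιA : (UnitaryGroup.adelicGroupData (Fp L) L (IsCMField.complexConj L) N H).Adelic →*
      UnitaryGroup.adelic (Fp L) L (IsCMField.complexConj L) N (Matrix.diagonal dV))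
    (φ₁ φ₂ : (UnitaryGroup.adelicGroupData (Fp L) L (IsCMField.complexConj L) N H).automorphicQuotient → ℂ) :
    ZetaSConverges L e dV hdV dW hdW H S νinf νS μ ιA (fun _ => 0) φ₁ φ₂ := by
  simp [ZetaSConverges]

end Global

end Literature.NumberTheory.K2Lit.SiegelDoubled

end
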